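import Summits.AtomisticToContinuum.Crystallization.Theorems.PricedLinkCensusLocalToGlobalDefs
import Literature.Analysis.FluidPDE.NewtonKernel

/-!
# Vocabulary for the confined Thomson inequality (stub `stub_confinedThomson`, line `flux-cell-joint-census`)

Route `PricedLinkCensus`, crux `LocalToGlobal` (stmt-AtomisticToContinuum-14232), line
`flux-cell-joint-census`, support for the registered stub `stub_confinedThomson : ConfinedThomson`
(`Theorems/PricedLinkCensusLocalToGlobalDefs`).  This file holds the DEFINITIONS of the proof of the
confined Thomson inequality with free transfer in `ℝ⁸` (so that the proof files
`PricedLinkCensusLocalToGlobalThomson*.lean`, `…ConfinedThomson.lean` are pure theorem files), together with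
the rfl/one-line lemmas about them:

* the splitting `ℝ⁸ = ℝ³ × ℝ⁵` of the flux tubes: `E5`, `projHi` (last five coordinates), the continuous
  linear maps `projL`, `embL` (the `Defs` file's `proj`, `emb`), the TRANSVERSE PART `perpL = id - emb ∘ proj`,
  the isometry `splitIso : ℝ⁸ ≃ₗᵢ WithLp 2 (ℝ³ × ℝ⁵)` and the measurable equivalence `splitMap : ℝ⁸ ≃ᵐ ℝ³ × ℝ⁵`;
* the regularised Newton kernel of `ℝ⁸`: the radial profile `farProfile8 t` (`g_t(σ) = (1 - Θ_{t/2,t}(σ)) σ⁻³`,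
  `Θ` the tree's `cutoffProfile`), its derivatives `farProfile8₁`, `farProfile8₂`, the kernel
  `newtonFar8 t` (`f_t(z) = g_t(‖z‖²)`: `= ‖z‖⁻⁶` for `‖z‖ ≥ t`, `= 0` for `‖z‖ ≤ t/2`, `0 ≤ f_t ≤ ‖·‖⁻⁶`), the
  profile `lapProfile8 t` of `Δ f_t`;
* the regularised potentials `farPotential t ρ = ∫ ρ(z) f_t(· - z) dz` and the self-interaction kernel
  `farSelfKernel t = ∫ Δf_t(x) f_t(· + x) dx`;
* the charge density `chargeDensity x ε = Σᵢ cᵢ 𝟙_{B(ι xᵢ, εᵢ)}`, `cᵢ = chargeConst x ε i = (vol Bᵢ)⁻¹`, and a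
  bounding radius `chargeRadius`;
* the transverse escape flux: `escapeIntegrand`, `escapeCoeff g x` (`Q_g(z) = ∫₀¹ w⁴ g(‖proj z - x‖² + ‖perp z‖² w²) dw`),
  `escapeField g x = Q_g · perp`, the profiles `escapeBump ε n` (smooth) and `sharpProfile ε = 𝟙_{(-∞, ε²)}`, and
  `escapeFlux x ε = (vol B(ι x, ε))⁻¹ · escapeField (sharpProfile ε) x`.

References: D. Gilbarg, N. S. Trudinger, *Elliptic PDE of second order* (2001), (2.12)–(2.18);
E. H. Lieb, M. Loss, *Analysis* (2001), Thm 6.20, §9.7; folklore.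
-/

noncomputable section

open MeasureTheory Set Filter Metric Topology InnerProductSpace Function
open scoped RealInnerProductSpace Laplacian
open Literature.Analysis.FluidPDE (cutoffProfile cutoffProfile_nonneg cutoffProfile_le_one cutoffProfile_eq_one
  cutoffProfile_eq_zero)

namespace Summit.AtomisticToContinuum.Crystallization.Theorems.PricedLinkCensusLocalToGlobal

/-! ## The splitting `ℝ⁸ = ℝ³ × ℝ⁵` -/

/-- Euclidean 5-space, the transverse factor of `ℝ⁸ = ℝ³ × ℝ⁵`. [folklore] -/
abbrev E5 := EuclideanSpace ℝ (Fin 5)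

/-! ### Coordinates -/

/-- Coordinates of `proj z`: the first three coordinates of `z`. [folklore] -/
@[simp] theorem proj_apply (z : E8) (i : Fin 3) : proj z i = z (Fin.castAdd 5 i) := rfl

/-- Coordinates of `emb a`: `a` padded by zeros. [folklore] -/
theorem emb_apply (a : E3) (k : Fin 8) : emb a k = if h : (k : ℕ) < 3 then a ⟨k, h⟩ else 0 := rfl

/-- `emb a` on the first three slots. [folklore] -/
@[simp] theorem emb_apply_castAdd (a : E3) (i : Fin 3) : emb a (Fin.castAdd 5 i) = a i := by
  rw [emb_apply, dif_pos (by simp [i.2])]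
  rfl

/-- `emb a` vanishes on the last five slots. [folklore] -/
@[simp] theorem emb_apply_natAdd (a : E3) (j : Fin 5) : emb a (Fin.natAdd 3 j) = 0 := by
  rw [emb_apply, dif_neg (by simp)]

/-- The last five coordinates `z″` of `z ∈ ℝ⁸`. [folklore] -/
def projHi (z : E8) : E5 := WithLp.toLp 2 fun j => z (Fin.natAdd 3 j)

/-- Coordinates of `projHi z`. [folklore] -/
@[simp] theorem projHi_apply (z : E8) (j : Fin 5) : projHi z j = z (Fin.natAdd 3 j) := rfl

/-! ### `proj`, `emb` as continuous linear maps; the transverse part -/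

/-- `proj` as a linear map. [folklore] -/
def projLin : E8 →ₗ[ℝ] E3 where
  toFun := proj
  map_add' z w := by ext i; simp
  map_smul' c z := by ext i; simp

/-- `proj : ℝ⁸ →L ℝ³`. [folklore] -/
def projL : E8 →L[ℝ] E3 := LinearMap.toContinuousLinearMap projLin

/-- `projL z = proj z`. [folklore] -/
@[simp] theorem projL_apply (z : E8) : projL z = proj z := rfl

/-- `emb` as a linear map. [folklore] -/
def embLin : E3 →ₗ[ℝ] E8 where
  toFun := emb
  map_add' a b := by
    ext k; simp only [emb_apply, PiLp.add_apply]; split_ifs <;> simp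
  map_smul' c a := by
    ext k; simp only [emb_apply, PiLp.smul_apply, RingHom.id_apply, smul_eq_mul]; split_ifs <;> simp

/-- `emb : ℝ³ →L ℝ⁸`. [folklore] -/
def embL : E3 →L[ℝ] E8 := LinearMap.toContinuousLinearMap embLin

/-- `embL a = emb a`. [folklore] -/
@[simp] theorem embL_apply (a : E3) : embL a = emb a := rfl

/-- **The transverse part** `perp = id - emb ∘ proj : ℝ⁸ →L ℝ⁸`, `z = (z′, z″) ↦ (0, z″)`. [folklore] -/
def perpL : E8 →L[ℝ] E8 := ContinuousLinearMap.id ℝ E8 - embL.comp projL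

/-- `perpL z = z - emb (proj z)`. [folklore] -/
theorem perpL_apply (z : E8) : perpL z = z - emb (proj z) := rfl

/-- Coordinates of the transverse part: zero on the first three slots. [folklore] -/
@[simp] theorem perpL_apply_castAdd (z : E8) (i : Fin 3) : perpL z (Fin.castAdd 5 i) = 0 := by
  simp [perpL_apply]

/-- Coordinates of the transverse part: `z` on the last five slots. [folklore] -/
@[simp] theorem perpL_apply_natAdd (z : E8) (j : Fin 5) : perpL z (Fin.natAdd 3 j) = z (Fin.natAdd 3 j) := by
  simp [perpL_apply]

/-- `proj (perp z) = 0`. [folklore] -/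
@[simp] theorem proj_perpL (z : E8) : proj (perpL z) = 0 := by
  ext i; simp

/-- `perp (emb a) = 0`. [folklore] -/
@[simp] theorem perpL_emb (a : E3) : perpL (emb a) = 0 := by
  rw [perpL_apply, proj_emb, sub_self]

/-- `emb 0 = 0`. [folklore] -/
@[simp] theorem emb_zero : emb (0 : E3) = 0 := map_zero embL

/-- `perp` is idempotent. [folklore] -/
@[simp] theorem perpL_perpL (z : E8) : perpL (perpL z) = perpL z := by
  conv_lhs => rw [perpL_apply]
  rw [proj_perpL, emb_zero, sub_zero]

/-- `projHi (perp z) = projHi z`. [folklore] -/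
@[simp] theorem projHi_perpL (z : E8) : projHi (perpL z) = projHi z := by
  ext j; simp

/-- Sums over `Fin 8` split as sums over the first three and the last five indices. [folklore] -/
theorem sum_fin8_split (f : Fin 8 → ℝ) : ∑ k, f k = ∑ i : Fin 3, f (Fin.castAdd 5 i) + ∑ j : Fin 5, f (Fin.natAdd 3 j) :=
  Fin.sum_univ_add (a := 3) (b := 5) f

/-- `‖z‖² = ‖proj z‖² + ‖projHi z‖²`. [folklore] -/
theorem norm_sq_eq_proj_projHi (z : E8) : ‖z‖ ^ 2 = ‖proj z‖ ^ 2 + ‖projHi z‖ ^ 2 := by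
  rw [EuclideanSpace.norm_sq_eq, EuclideanSpace.norm_sq_eq, EuclideanSpace.norm_sq_eq, sum_fin8_split]
  rfl

/-- `‖perp z‖ = ‖projHi z‖`. [folklore] -/
theorem norm_perpL (z : E8) : ‖perpL z‖ = ‖projHi z‖ := by
  have h := norm_sq_eq_proj_projHi (perpL z)
  rw [proj_perpL, norm_zero, projHi_perpL] at h
  simp only [ne_eq, OfNat.ofNat_ne_zero, not_false_eq_true, zero_pow, zero_add] at h
  exact (sq_eq_sq₀ (norm_nonneg _) (norm_nonneg _)).1 h

/-- `‖perp z‖ ≤ ‖z‖`. [folklore] -/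
theorem norm_perpL_le (z : E8) : ‖perpL z‖ ≤ ‖z‖ := by
  have h := norm_sq_eq_proj_projHi z
  rw [← norm_perpL] at h
  nlinarith [norm_nonneg (perpL z), norm_nonneg z, sq_nonneg ‖proj z‖]

/-- `‖proj z‖ ≤ ‖z‖` (`proj` is a contraction). [folklore] -/
theorem norm_proj_le (z : E8) : ‖proj z‖ ≤ ‖z‖ := by
  have h := norm_sq_eq_proj_projHi z
  nlinarith [norm_nonneg (proj z), norm_nonneg z, sq_nonneg ‖projHi z‖]

/-- `proj (z - emb x) = proj z - x`. [folklore] -/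
@[simp] theorem proj_sub_emb (z : E8) (x : E3) : proj (z - emb x) = proj z - x := by
  have h : proj (z - emb x) = proj z - proj (emb x) := map_sub projL z (emb x)
  rw [h, proj_emb]

/-- `projHi (z - emb x) = projHi z`. [folklore] -/
@[simp] theorem projHi_sub_emb (z : E8) (x : E3) : projHi (z - emb x) = projHi z := by
  ext j; simp

/-- **Pythagorean splitting about a centre on `ι(ℝ³)`**: `‖z - emb x‖² = ‖proj z - x‖² + ‖perp z‖²`. [folklore] -/
theorem norm_sub_emb_sq (z : E8) (x : E3) : ‖z - emb x‖ ^ 2 = ‖proj z - x‖ ^ 2 + ‖perpL z‖ ^ 2 := by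
  rw [norm_sq_eq_proj_projHi (z - emb x), norm_perpL, proj_sub_emb, projHi_sub_emb]

/-- The 8-ball about `emb x` lies in the tube over the 3-ball about `x`. [folklore] -/
theorem proj_mem_ball_of_mem_ball {z : E8} {x : E3} {ε : ℝ} (hz : z ∈ ball (emb x) ε) : proj z ∈ ball x ε := by
  rw [mem_ball, dist_eq_norm] at hz ⊢
  rw [← proj_sub_emb]
  exact (norm_proj_le _).trans_lt hz

/-! ### The isometry `ℝ⁸ ≃ ℝ³ × ℝ⁵` and the product measure -/

/-- Glue `(a, b) ∈ ℝ³ × ℝ⁵` into a vector of `ℝ⁸` (inverse of `z ↦ (proj z, projHi z)`). [folklore] -/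
def glue (p : WithLp 2 (E3 × E5)) : E8 := WithLp.toLp 2 (Fin.append (WithLp.ofLp p.fst) (WithLp.ofLp p.snd))

/-- `glue` on the first three slots. [folklore] -/
@[simp] theorem glue_apply_castAdd (p : WithLp 2 (E3 × E5)) (i : Fin 3) : glue p (Fin.castAdd 5 i) = p.fst i := by
  simp [glue]

/-- `glue` on the last five slots. [folklore] -/
@[simp] theorem glue_apply_natAdd (p : WithLp 2 (E3 × E5)) (j : Fin 5) : glue p (Fin.natAdd 3 j) = p.snd j := by
  simp [glue]

/-- Extensionality on `WithLp 2 (ℝ³ × ℝ⁵)` through the two components. [folklore] -/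
theorem withLp_prod_ext {p q : WithLp 2 (E3 × E5)} (h1 : p.fst = q.fst) (h2 : p.snd = q.snd) : p = q :=
  WithLp.ofLp_injective 2 (Prod.ext h1 h2)

/-- `projHi` is additive. [folklore] -/
theorem projHi_add (z w : E8) : projHi (z + w) = projHi z + projHi w := by
  ext j; simp

/-- `projHi` is homogeneous. [folklore] -/
theorem projHi_smul (c : ℝ) (z : E8) : projHi (c • z) = c • projHi z := by
  ext j; simp

/-- The splitting `z ↦ (proj z, projHi z)` as a linear equivalence `ℝ⁸ ≃ₗ WithLp 2 (ℝ³ × ℝ⁵)`. [folklore] -/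
def splitEquiv : E8 ≃ₗ[ℝ] WithLp 2 (E3 × E5) where
  toFun z := WithLp.toLp 2 (proj z, projHi z)
  map_add' z w := by
    refine withLp_prod_ext ?_ ?_
    · exact map_add projL z w
    · exact projHi_add z w
  map_smul' c z := by
    refine withLp_prod_ext ?_ ?_
    · exact map_smul projL c z
    · exact projHi_smul c z
  invFun := glue
  left_inv z := by
    ext k
    refine Fin.addCases (m := 3) (n := 5) (fun i => ?_) (fun j => ?_) k
    · simp
    · simp
  right_inv p := by
    refine withLp_prod_ext ?_ ?_
    · ext i; simp
    · ext j; simp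

/-- **The splitting is a linear isometry** `ℝ⁸ ≃ₗᵢ WithLp 2 (ℝ³ × ℝ⁵)` (`‖z‖² = ‖z′‖² + ‖z″‖²`). [folklore] -/
def splitIso : E8 ≃ₗᵢ[ℝ] WithLp 2 (E3 × E5) :=
  { splitEquiv with
    norm_map' := fun z => by
      have h1 : ‖splitEquiv z‖ ^ 2 = ‖z‖ ^ 2 := by
        rw [WithLp.prod_norm_sq_eq_of_L2, norm_sq_eq_proj_projHi]
        rfl
      exact (sq_eq_sq₀ (norm_nonneg _) (norm_nonneg _)).1 h1 }

/-- `splitIso z = (proj z, projHi z)`. [folklore] -/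
@[simp] theorem splitIso_apply (z : E8) : splitIso z = WithLp.toLp 2 (proj z, projHi z) := rfl

/-- The measurable splitting map `ℝ⁸ → ℝ³ × ℝ⁵`, `z ↦ (proj z, projHi z)`. [folklore] -/
def splitMap : E8 ≃ᵐ E3 × E5 := splitIso.toMeasurableEquiv.trans (MeasurableEquiv.toLp 2 (E3 × E5)).symm

/-- `splitMap z = (proj z, projHi z)`. [folklore] -/
@[simp] theorem splitMap_apply (z : E8) : splitMap z = (proj z, projHi z) := rfl

/-! ## The regularised Newton kernel of `ℝ⁸` -/

section Kernel

variable {t : ℝ}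

/-- The radial profile `g_t(σ) = (1 - Θ_{t/2,t}(σ)) · σ⁻³` of the regularised kernel
(`f_t(z) = g_t(‖z‖²)`; `Θ` the tree's `cutoffProfile`, `= 1` for `σ ≤ t²/4`, `= 0` for `σ ≥ t²`). [folklore] -/
def farProfile8 (t σ : ℝ) : ℝ := (1 - cutoffProfile (t / 2) t σ) * (σ ^ (-3 : ℤ))

/-- `g_t = 0` near every `σ < t²/4`. [folklore] -/
theorem farProfile8_eventuallyEq_zero (ht : 0 < t) {σ : ℝ} (hσ : σ < (t / 2) ^ 2) :
    farProfile8 t =ᶠ[𝓝 σ] fun _ => 0 := by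
  filter_upwards [isOpen_Iio.mem_nhds hσ] with τ hτ
  rw [farProfile8, cutoffProfile_eq_one (by positivity) (by linarith) (le_of_lt hτ), sub_self, zero_mul]

/-- `g_t = σ⁻³` near every `σ > t²`. [folklore] -/
theorem farProfile8_eventuallyEq_zpow (ht : 0 < t) {σ : ℝ} (hσ : t ^ 2 < σ) :
    farProfile8 t =ᶠ[𝓝 σ] fun τ => τ ^ (-3 : ℤ) := by
  filter_upwards [isOpen_Ioi.mem_nhds hσ] with τ hτ
  rw [farProfile8, cutoffProfile_eq_zero (by positivity) (by linarith) (le_of_lt hτ), sub_zero, one_mul]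

/-- `g_t(σ) = σ⁻³` for `σ ≥ t²`. [folklore] -/
theorem farProfile8_eq_zpow (ht : 0 < t) {σ : ℝ} (hσ : t ^ 2 ≤ σ) :
    farProfile8 t σ = σ ^ (-3 : ℤ) := by
  rw [farProfile8, cutoffProfile_eq_zero (by positivity) (by linarith) hσ, sub_zero, one_mul]

/-- `g_t(σ) = 0` for `σ ≤ t²/4`. [folklore] -/
theorem farProfile8_eq_zero (ht : 0 < t) {σ : ℝ} (hσ : σ ≤ (t / 2) ^ 2) : farProfile8 t σ = 0 := by
  rw [farProfile8, cutoffProfile_eq_one (by positivity) (by linarith) hσ, sub_self, zero_mul]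

/-- `0 ≤ g_t(σ) ≤ σ⁻³` for `σ ≥ 0`... precisely: `|g_t(σ)| ≤ |σ ^ (-3)|` always (`0 ≤ 1 - Θ ≤ 1`). [folklore] -/
theorem abs_farProfile8_le (t σ : ℝ) : |farProfile8 t σ| ≤ |σ ^ (-3 : ℤ)| := by
  rw [farProfile8, abs_mul]
  refine mul_le_of_le_one_left (abs_nonneg _) ?_
  rw [abs_le]
  constructor <;> linarith [cutoffProfile_nonneg (t / 2) t σ, cutoffProfile_le_one (t / 2) t σ]

/-- `0 ≤ g_t(σ)` for `σ ≥ 0`. [folklore] -/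
theorem farProfile8_nonneg (t : ℝ) {σ : ℝ} (hσ : 0 ≤ σ) : 0 ≤ farProfile8 t σ :=
  mul_nonneg (by linarith [cutoffProfile_le_one (t / 2) t σ]) (zpow_nonneg hσ _)

/-- First derivative of the profile. [folklore] -/
def farProfile8₁ (t : ℝ) : ℝ → ℝ := deriv (farProfile8 t)

/-- Second derivative of the profile. [folklore] -/
def farProfile8₂ (t : ℝ) : ℝ → ℝ := deriv (farProfile8₁ t)

/-- **The regularised Newton kernel** `f_t(z) = g_t(‖z‖²) = (1 - θ_{t/2,t}(z)) ‖z‖⁻⁶` of `ℝ⁸`. [folklore] -/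
def newtonFar8 (t : ℝ) (z : E8) : ℝ := farProfile8 t (‖z‖ ^ 2)

/-- `f_t = g_t(‖·‖²)`, function form. [folklore] -/
theorem newtonFar8_eq_profile (t : ℝ) : newtonFar8 t = fun z : E8 => farProfile8 t (‖z‖ ^ 2) := rfl

/-- `f_t(z) = ‖z‖⁻⁶` for `‖z‖ ≥ t`. [folklore] -/
theorem newtonFar8_eq_of_le (ht : 0 < t) {z : E8} (hz : t ≤ ‖z‖) : newtonFar8 t z = ‖z‖⁻¹ ^ 6 := by
  rw [newtonFar8, farProfile8_eq_zpow ht (pow_le_pow_left₀ ht.le hz 2), zpow_neg, zpow_ofNat, ← pow_mul, inv_pow]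

/-- `f_t(z) = 0` for `‖z‖ ≤ t/2`. [folklore] -/
theorem newtonFar8_eq_zero (ht : 0 < t) {z : E8} (hz : ‖z‖ ≤ t / 2) : newtonFar8 t z = 0 :=
  farProfile8_eq_zero ht (pow_le_pow_left₀ (norm_nonneg _) hz 2)

/-- `0 ≤ f_t`. [folklore] -/
theorem newtonFar8_nonneg (t : ℝ) (z : E8) : 0 ≤ newtonFar8 t z := farProfile8_nonneg t (sq_nonneg _)

/-- `f_t ≤ ‖·‖⁻⁶`. [folklore] -/
theorem newtonFar8_le (t : ℝ) (z : E8) : newtonFar8 t z ≤ ‖z‖⁻¹ ^ 6 := by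
  have h := abs_farProfile8_le t (‖z‖ ^ 2)
  rw [abs_of_nonneg (farProfile8_nonneg t (sq_nonneg _)), abs_of_nonneg (zpow_nonneg (sq_nonneg _) _),
    show ((‖z‖ ^ 2) ^ (-3 : ℤ) : ℝ) = ‖z‖⁻¹ ^ 6 by rw [zpow_neg, zpow_ofNat, ← pow_mul, inv_pow]] at h
  exact h

/-- `|f_t| ≤ ‖·‖⁻⁶`. [folklore] -/
theorem abs_newtonFar8_le (t : ℝ) (z : E8) : |newtonFar8 t z| ≤ ‖z‖⁻¹ ^ 6 := by
  rw [abs_of_nonneg (newtonFar8_nonneg t z)]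
  exact newtonFar8_le t z

/-- The radial profile `Λ_t(r) = 4 g″(r²) r² + 16 g′(r²)` of `Δ f_t` (`Δf_t(z) = Λ_t(‖z‖)`). [folklore] -/
def lapProfile8 (t r : ℝ) : ℝ := 4 * farProfile8₂ t (r ^ 2) * r ^ 2 + 16 * farProfile8₁ t (r ^ 2)

/-- **Registered sub-goal `newtonFar8_le_kernel`**: the regularised kernel never exceeds the Newton kernel,
`f_t(z) ≤ ‖z‖⁻⁶` (binder form of `newtonFar8_le`). [folklore] -/
theorem newtonFar8_le_kernel : ∀ (t : ℝ) (z : E8), newtonFar8 t z ≤ ‖z‖⁻¹ ^ 6 :=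
  fun t z => newtonFar8_le t z

end Kernel

/-! ## Regularised potentials and the self-interaction kernel -/

/-- **The regularised Newton potential** `v(x) = ∫ ρ(z) f_t(x - z) dz` of a density `ρ` against the
regularised kernel `f_t = newtonFar8 t` of `ℝ⁸`. [folklore] -/
def farPotential (t : ℝ) (ρ : E8 → ℝ) (x : E8) : ℝ := ∫ z, ρ z * newtonFar8 t (x - z)

/-- `m_t(y) = ∫ Δf_t(x) f_t(y + x) dx`, the self-interaction kernel of the regularisation. [folklore] -/
def farSelfKernel (t : ℝ) (y : E8) : ℝ := ∫ x, (Δ (newtonFar8 t)) x * newtonFar8 t (y + x)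

/-! ## The charge density of a smeared configuration -/

section Charge

variable {N : ℕ}

/-- The normalising constants `cᵢ = (vol B(ι xᵢ, εᵢ))⁻¹` (`= 0` for an empty ball). [folklore] -/
def chargeConst (x : Fin N → E3) (ε : Fin N → ℝ) (i : Fin N) : ℝ :=
  ((volume : Measure E8).real (ball (emb (x i)) (ε i)))⁻¹

/-- **The charge density** `ρ = Σᵢ cᵢ 𝟙_{B(ι xᵢ, εᵢ)}` of the smeared configuration. [folklore] -/
def chargeDensity (x : Fin N → E3) (ε : Fin N → ℝ) (z : E8) : ℝ :=
  ∑ i, chargeConst x ε i * (ball (emb (x i)) (ε i)).indicator (fun _ => (1 : ℝ)) z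

variable (x : Fin N → E3) (ε : Fin N → ℝ) in
/-- A radius beyond which `ρ` vanishes: `R₀ = Σᵢ (‖ι xᵢ‖ + |εᵢ|)`. [folklore] -/
def chargeRadius : ℝ := ∑ i, (‖emb (x i)‖ + |ε i|)

end Charge

/-! ## The transverse escape flux -/

/-- The integrand `(w, z) ↦ w⁴ g(‖proj z - x‖² + ‖perp z‖² w²)`. [folklore] -/
def escapeIntegrand (g : ℝ → ℝ) (x : E3) (q : ℝ × E8) : ℝ :=
  q.1 ^ 4 * g (‖proj q.2 - x‖ ^ 2 + ‖perpL q.2‖ ^ 2 * q.1 ^ 2)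

/-- **The escape coefficient** `Q_g(z) = ∫₀¹ w⁴ g(‖proj z - x‖² + ‖perp z‖² w²) dw`. [folklore] -/
def escapeCoeff (g : ℝ → ℝ) (x : E3) (z : E8) : ℝ := ∫ w in (0 : ℝ)..1, escapeIntegrand g x (w, z)

/-- **The escape field** `H_g(z) = Q_g(z) · perp z` (transverse, radial in `z″`). [folklore] -/
def escapeField (g : ℝ → ℝ) (x : E3) (z : E8) : E8 := escapeCoeff g x z • perpL z

/-- The smooth approximating profiles `g_n = Θ_{r_n, ε}`, `r_n = ε - ε/(n+2) ↑ ε`. [folklore] -/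
def escapeBump (ε : ℝ) (n : ℕ) : ℝ → ℝ := cutoffProfile (ε - ε / ((n : ℝ) + 2)) ε

/-- The sharp profile `g_∞ = 𝟙_{(-∞, ε²)}`. [folklore] -/
def sharpProfile (ε s : ℝ) : ℝ := if s < ε ^ 2 then 1 else 0

/-- **The escape flux** of the unit charge smeared on `B(ι x, ε)`: `(vol B(ι x, ε))⁻¹ · H_{g_∞}`. [folklore] -/
def escapeFlux (x : E3) (ε : ℝ) (z : E8) : E8 :=
  ((volume : Measure E8).real (ball (emb x) ε))⁻¹ • escapeField (sharpProfile ε) x z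

end Summit.AtomisticToContinuum.Crystallization.Theorems.PricedLinkCensusLocalToGlobal

end
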